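import Mathlib
import Summits.Ventures.PercRepro2.Defs
import Summits.Ventures.PercRepro2.Independence
import Summits.Ventures.PercRepro2.Harris
import Summits.Ventures.PercRepro2.Graph
import Summits.Ventures.PercRepro2.Exploration
import Summits.Ventures.PercRepro2.Events
import Summits.Ventures.PercRepro2.CutVertexDefs
import Summits.Ventures.PercRepro2.CDCutVertex
import Summits.Ventures.PercRepro2.CDCutAC
import Summits.Ventures.PercRepro2.CDNestedAC
import Summits.Ventures.PercRepro2.CDBlockNested

/-!
# The simple paths of one side of a cut, and the block-nested theorems with the comparability
hypothesis on the side alone (blind cell PercRepro2, mine-a g36; MINE-A.md §91.10)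

The block-nested theorems of `CDBlockNested` ask that the simple paths between two near-side vertices
of a cut have comparable vertex sets, quantified over the simple paths OF THE WHOLE GRAPH.  Such a path
never uses a far-side edge: a walk from the far side `VB` to the near side passes the cut vertex
(`cut_mem_support_of_walk`), so a simple path between near-side vertices that took a far-side edge
would start that edge at the cut vertex and come back to it (`darts_near_of_isPath`).  Hence every such
path transfers to the NEAR-SIDE graph (the open graph of the configuration with the near side open and
the far side closed, `Walk.transfer`), with the same support, and the comparability hypothesis may be
stated for the paths of the side alone (`chain_of_near`): `cd_of_nested_far'`, `cd_of_nested_root'`,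
`cd_of_nested_between'`.  No definition; one seat.
-/

namespace Summit.Ventures.PercRepro2

namespace CDSidePaths

section Walks

variable {V : Type*} {E : Type*} {ends : E → Sym2 V} {z : V} {VA VB : Set V} {EA EB : Set E}

/-- **A walk from the far side to the near side passes the cut vertex.** -/
lemma cut_mem_support_of_walk (h : CutV.IsCut ends z VA VB EA EB) {ω : Config E} :
    ∀ {u w : V} (W : (openGraph ends ω).Walk u w), u ∈ VB → w ∈ VA → z ∈ W.support := by
  intro u w W
  induction W with
  | nil =>
    intro hu hw
    exact absurd hu (Set.disjoint_left.1 h.disj hw)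
  | @cons a b c hadj W' ih =>
    intro ha hc
    obtain ⟨_, e, _, hends⟩ := openGraph_adj.1 hadj
    rw [SimpleGraph.Walk.support_cons]
    rcases h.cover e with hA | hB
    · exact absurd (h.ends_mem_of_mem_EA hA hends).1 (h.notMem_of_mem_B ha)
    · rcases (h.symm.ends_mem_of_mem_EA hB hends).2 with hb | hb
      · exact List.mem_cons_of_mem _ (ih hb hc)
      · rw [Set.mem_singleton_iff] at hb
        subst hb
        exact List.mem_cons_of_mem _ W'.start_mem_support

/-- **A simple path between two near-side vertices uses near-side edges only**: every dart comes from
an edge of `EA`. -/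
lemma darts_near_of_isPath (h : CutV.IsCut ends z VA VB EA EB) {ω : Config E} :
    ∀ {u w : V} (P : (openGraph ends ω).Walk u w), P.IsPath → u ∈ VA ∪ {z} → w ∈ VA ∪ {z} →
      ∀ d ∈ P.darts, ∃ e ∈ EA, ends e = s(d.fst, d.snd) := by
  intro u w P
  induction P with
  | nil =>
    intro _ _ _ d hd
    simp at hd
  | @cons a b c hadj P' ih =>
    intro hP ha hc d hd
    rw [SimpleGraph.Walk.cons_isPath_iff] at hP
    obtain ⟨hne, e, _, hends⟩ := openGraph_adj.1 hadj
    -- the first edge is a near-side edge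
    have heA : e ∈ EA := by
      rcases h.cover e with hA | hB
      · exact hA
      · exfalso
        have hab := h.symm.ends_mem_of_mem_EA hB hends
        have haz : a = z := by
          rcases ha with ha | ha
          · rcases hab.1 with h1 | h1
            · exact absurd ha (Set.disjoint_right.1 h.disj h1)
            · exact h1
          · exact ha
        have hbB : b ∈ VB := by
          rcases hab.2 with h1 | h1
          · exact h1
          · rw [Set.mem_singleton_iff] at h1
            exact absurd (haz.trans h1.symm) hne
        rcases hc with hcA | hcz
        · exact hP.2 (haz ▸ cut_mem_support_of_walk h P' hbB hcA)
        · rw [Set.mem_singleton_iff] at hcz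
          subst hcz
          exact hP.2 (haz ▸ P'.end_mem_support)
    rw [SimpleGraph.Walk.darts_cons, List.mem_cons] at hd
    rcases hd with rfl | hd
    · exact ⟨e, heA, hends⟩
    · exact ih hP.1 (h.ends_mem_of_mem_EA heA hends).2 hc d hd

/-- The edges of a simple path between two near-side vertices are edges of the near-side graph (the
configuration with the near side open and the far side closed). -/
lemma edges_mem_near (h : CutV.IsCut ends z VA VB EA EB) [DecidablePred (· ∈ EA)] {u w : V}
    (hu : u ∈ VA ∪ {z}) (hw : w ∈ VA ∪ {z}) (P : (openGraph ends (fun _ => true)).Walk u w)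
    (hP : P.IsPath) :
    ∀ s ∈ P.edges, s ∈ (openGraph ends (restrict EA (fun _ => true))).edgeSet := by
  intro s hs
  simp only [SimpleGraph.Walk.edges, List.mem_map] at hs
  obtain ⟨d, hd, rfl⟩ := hs
  obtain ⟨e, heA, hends⟩ := darts_near_of_isPath h P hP hu hw d hd
  show (openGraph ends (restrict EA fun _ => true)).Adj d.fst d.snd
  rw [openGraph_adj]
  exact ⟨d.adj.ne, e, restrict_apply_of_mem heA, hends⟩

/-- **The comparability hypothesis on the near side alone suffices**: if any two simple `u–w` paths of
the near-side graph avoiding `a₂` have comparable vertex sets, so do any two simple `u–w` paths of the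
whole graph avoiding `a₂` (`u, w` on the near side). -/
theorem chain_of_near [DecidableEq V] (h : CutV.IsCut ends z VA VB EA EB) [DecidablePred (· ∈ EA)]
    {u w a₂ : V}
    (hu : u ∈ VA ∪ {z}) (hw : w ∈ VA ∪ {z})
    (hchain : ∀ P P' : (openGraph ends (restrict EA (fun _ => true))).Path u w,
      a₂ ∉ P.1.support → a₂ ∉ P'.1.support →
      P.1.support.toFinset ⊆ P'.1.support.toFinset ∨ P'.1.support.toFinset ⊆ P.1.support.toFinset) :
    ∀ P P' : (openGraph ends (fun _ => true)).Path u w,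
      a₂ ∉ P.1.support → a₂ ∉ P'.1.support →
      P.1.support.toFinset ⊆ P'.1.support.toFinset ∨ P'.1.support.toFinset ⊆ P.1.support.toFinset := by
  intro P P' hP hP'
  have key := hchain ⟨P.1.transfer _ (edges_mem_near h hu hw P.1 P.2), P.2.transfer _⟩
    ⟨P'.1.transfer _ (edges_mem_near h hu hw P'.1 P'.2), P'.2.transfer _⟩
    (by rwa [SimpleGraph.Walk.support_transfer]) (by rwa [SimpleGraph.Walk.support_transfer])
  simpa only [SimpleGraph.Walk.support_transfer] using key

end Walks

section Theorems

variable {V : Type*} {E : Type*} [Fintype E] [DecidableEq E] [Fintype V] [DecidableEq V]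
  {R : Type*} [Field R] [LinearOrder R] [IsStrictOrderedRing R]

variable {ends : E → Sym2 V} {VA VB : Set V} {EA EB : Set E} [DecidablePred (· ∈ EA)]
  [DecidablePred (· ∈ EB)]

/-- `CDBlockNested.cd_of_nested_far` with the comparability hypothesis on the near-side graph. -/
theorem cd_of_nested_far' (p : E → R) (hp : IsProbVec p) (hinj : Function.Injective ends) {v : V}
    (h : CutV.IsCut ends v VA VB EA EB) {a₁ a₂ a₃ o : V} (ha₁ : a₁ ∈ VA ∪ {v})
    (ha₂ : a₂ ∈ VA ∪ {v}) (ho : o ∈ VA ∪ {v}) (ha₃ : a₃ ∈ VB) {𝓔 : Set (Set V)}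
    (h𝓔 : IsUpperSet 𝓔)
    (hchain : ∀ P P' : (openGraph ends (restrict EA (fun _ => true))).Path a₁ v,
      a₂ ∉ P.1.support → a₂ ∉ P'.1.support →
      P.1.support.toFinset ⊆ P'.1.support.toFinset ∨ P'.1.support.toFinset ⊆ P.1.support.toFinset) :
    let Q := (connEvent ends a₁ a₂)ᶜ
    let U := clusterInEvent ends a₁ 𝓔
    let e := connEvent ends a₁ a₃
    let f := connEvent ends a₂ o
    let N := (connEvent ends a₁ a₃)ᶜ ∩ (connEvent ends a₂ a₃)ᶜ
    let oU := connEvent ends a₁ o ∪ connEvent ends a₂ o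
    prob p (Q ∩ N) * (prob p Q * prob p (Q ∩ U ∩ e ∩ f) - prob p (Q ∩ U) * prob p (Q ∩ e ∩ f)) ≤
      prob p (Q ∩ N ∩ oU) * (prob p Q * prob p (Q ∩ U ∩ e) - prob p (Q ∩ U) * prob p (Q ∩ e)) :=
  CDBlockNested.cd_of_nested_far p hp hinj h ha₁ ha₂ ho ha₃ h𝓔
    (chain_of_near h ha₁ (Or.inr rfl) hchain)

/-- `CDBlockNested.cd_of_nested_root` with the comparability hypothesis on the far-side graph. -/
theorem cd_of_nested_root' (p : E → R) (hp : IsProbVec p) (hinj : Function.Injective ends) {y : V}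
    (h : CutV.IsCut ends y VA VB EA EB) {a₁ a₂ a₃ o : V} (ha₁ : a₁ ∈ VA ∪ {y}) (ha₂ : a₂ ∈ VB)
    (ho : o ∈ VB) (ha₃ : a₃ ∈ VB ∪ {y}) {𝓔 : Set (Set V)} (h𝓔 : IsUpperSet 𝓔)
    (hchain : ∀ P P' : (openGraph ends (restrict EB (fun _ => true))).Path y a₃,
      a₂ ∉ P.1.support → a₂ ∉ P'.1.support →
      P.1.support.toFinset ⊆ P'.1.support.toFinset ∨ P'.1.support.toFinset ⊆ P.1.support.toFinset) :
    let Q := (connEvent ends a₁ a₂)ᶜ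
    let U := clusterInEvent ends a₁ 𝓔
    let e := connEvent ends a₁ a₃
    let f := connEvent ends a₂ o
    let N := (connEvent ends a₁ a₃)ᶜ ∩ (connEvent ends a₂ a₃)ᶜ
    let oU := connEvent ends a₁ o ∪ connEvent ends a₂ o
    prob p (Q ∩ N) * (prob p Q * prob p (Q ∩ U ∩ e ∩ f) - prob p (Q ∩ U) * prob p (Q ∩ e ∩ f)) ≤
      prob p (Q ∩ N ∩ oU) * (prob p Q * prob p (Q ∩ U ∩ e) - prob p (Q ∩ U) * prob p (Q ∩ e)) :=
  CDBlockNested.cd_of_nested_root p hp hinj h ha₁ ha₂ ho ha₃ h𝓔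
    (chain_of_near h.symm (Or.inr rfl) ha₃ hchain)

/-- `CDBlockNested.cd_of_nested_between` with the comparability hypothesis on the near-side graph of
the cut at `v` (a simple `y–v` path never enters the side of `y` either: it would pass `y` twice). -/
theorem cd_of_nested_between' (p : E → R) (hp : IsProbVec p) (hinj : Function.Injective ends)
    {y v : V} (h : CutV.IsCut ends y VA VB EA EB) {VA' VB' : Set V} {EA' EB' : Set E}
    [DecidablePred (· ∈ EA')] [DecidablePred (· ∈ EB')] (h' : CutV.IsCut ends v VA' VB' EA' EB')
    {a₁ a₂ a₃ o : V} (ha₁ : a₁ ∈ VA ∪ {y}) (ha₂ : a₂ ∈ VB) (ho : o ∈ VB) (ha₃ : a₃ ∈ VB)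
    (hy : y ∈ VA' ∪ {v}) (ha₂' : a₂ ∈ VA' ∪ {v}) (ho' : o ∈ VA' ∪ {v}) (ha₃' : a₃ ∈ VB')
    {𝓔 : Set (Set V)} (h𝓔 : IsUpperSet 𝓔)
    (hchain : ∀ P P' : (openGraph ends (restrict EA' (fun _ => true))).Path y v,
      a₂ ∉ P.1.support → a₂ ∉ P'.1.support →
      P.1.support.toFinset ⊆ P'.1.support.toFinset ∨ P'.1.support.toFinset ⊆ P.1.support.toFinset) :
    let Q := (connEvent ends a₁ a₂)ᶜ
    let U := clusterInEvent ends a₁ 𝓔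
    let e := connEvent ends a₁ a₃
    let f := connEvent ends a₂ o
    let N := (connEvent ends a₁ a₃)ᶜ ∩ (connEvent ends a₂ a₃)ᶜ
    let oU := connEvent ends a₁ o ∪ connEvent ends a₂ o
    prob p (Q ∩ N) * (prob p Q * prob p (Q ∩ U ∩ e ∩ f) - prob p (Q ∩ U) * prob p (Q ∩ e ∩ f)) ≤
      prob p (Q ∩ N ∩ oU) * (prob p Q * prob p (Q ∩ U ∩ e) - prob p (Q ∩ U) * prob p (Q ∩ e)) :=
  CDBlockNested.cd_of_nested_between p hp hinj h h' ha₁ ha₂ ho ha₃ hy ha₂' ho' ha₃' h𝓔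
    (chain_of_near h' hy (Or.inr rfl) hchain)

end Theorems

end CDSidePaths

end Summit.Ventures.PercRepro2
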